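import Mathlib.Analysis.Complex.BorelCaratheodory
import Literature.Analysis.Complex.VitaliConvergence
import Literature.Analysis.Complex.LogDerivZeros
import HarnessLib

/-!
# `TubeZeroFreeChannel` — negative-side support I: uniform zero-freeness about a real point forces analyticity

Support file for the crux `stmt-QuantumFields-18841`
(`Summit.QuantumFields.YangMills.Theses.ComplexCouplingChannel.TubeZeroFreeChannel`), extracted from
the standing disprover's work file `Cruxes/TubeZeroFreeChannel/Disproof.lean`; the analytic half of
the wall theorems of `Negative/AxisBlocking.lean`. Pure complex analysis, everything proved, no
definitions.

* `exists_normalisedLog`: a zero-free holomorphic `F` on a disc `B(c, R)` about a real `c`, real and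
  positive on the diameter, with `e^{-KV} ≤ |F(c)|` and `|F| ≤ e^{KV}`, is `exp(V·G)` with `G`
  holomorphic, real on the diameter (`= V⁻¹ log |F|` there) and `|G| ≤ 5K + 2` on `B(c, R/2)`
  UNIFORMLY in the volume `V ≥ 1` (holomorphic logarithm `exists_log_on_ball` + Mathlib's
  Borel–Carathéodory `Complex.borelCaratheodory_zero`).
* `exists_limit_of_real_limits`: Vitali's theorem on a disc for bounded holomorphic functions
  converging at the real points of the diameter (`Literature/Analysis/Complex/VitaliConvergence`);
  `analyticAt_of_eq_on_diameter`: the real trace of a holomorphic function is real analytic.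
* `analyticAt_of_uniformly_zeroFree`: the iterated-limit statement matching the crux's quantifier
  shape `∃ L₀ ∀ L ≥ L₀ ∃ t₀ ∀ t ≥ t₀`: if the `Z L t` are uniformly zero-free on `B(c, R)` and the
  rates `e L x = lim_t V⁻¹ log |Z L t x|`, `f x = lim_L e L x` exist on the diameter, then `f` is real
  analytic at `c`. Contrapositively: a real non-analyticity of the limiting free energy is never inside
  a uniformly zero-free open set — the mechanism by which first-order bulk transitions force the
  crux's channels off the real axis (`AxisBlocking.lean`).
-/

noncomputable section

open Filter Set Metric Topology
open Literature.Analysis.Complex (exists_log_on_ball exists_tendstoLocallyUniformlyOn_of_frequently_tendsto)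

namespace Summit.QuantumFields.YangMills.Theorems.TubeZeroFreeChannel.Negative

/-! ### I. Complex analysis: uniform zero-freeness near a real point and analyticity of the limit -/

section Analysis

open Complex

/-- Real points of the real interval `(c - R, c + R)` lie in the complex ball `B(c, R)`. [folklore] -/
theorem ofReal_mem_ball_iff {c R x : ℝ} : (x : ℂ) ∈ ball (c : ℂ) R ↔ |x - c| < R := by
  rw [mem_ball, dist_eq_norm, ← Complex.ofReal_sub, Complex.norm_real, Real.norm_eq_abs]

/-- A continuous real function on an interval around `c` with values in `2πℤ` and vanishing at `c`
vanishes on the interval (intermediate value theorem). [folklore] -/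
theorem eq_zero_of_continuousOn_of_two_pi_int {h : ℝ → ℝ} {c R : ℝ}
    (hc : ContinuousOn h (Ioo (c - R) (c + R))) (h0 : h c = 0)
    (hval : ∀ x ∈ Ioo (c - R) (c + R), ∃ n : ℤ, h x = 2 * Real.pi * n)
    {x : ℝ} (hx : x ∈ Ioo (c - R) (c + R)) : h x = 0 := by
  obtain ⟨n, hn⟩ := hval x hx
  by_contra hne
  have hn0 : n ≠ 0 := by rintro rfl; simp [hn] at hne
  have hcI : c ∈ Ioo (c - R) (c + R) := by
    have : 0 < R := by
      rcases hx with ⟨h1, h2⟩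
      by_contra hR; push Not at hR; linarith
    exact ⟨by linarith, by linarith⟩
  -- the segment between `c` and `x` lies in the interval
  have hsub : uIcc c x ⊆ Ioo (c - R) (c + R) := by
    intro y hy
    rcases mem_uIcc.1 hy with ⟨h1, h2⟩ | ⟨h1, h2⟩
    · exact ⟨lt_of_lt_of_le hcI.1 h1, lt_of_le_of_lt h2 hx.2⟩
    · exact ⟨lt_of_lt_of_le hx.1 h1, lt_of_le_of_lt h2 hcI.2⟩
  have hcont : ContinuousOn h (uIcc c x) := hc.mono hsub
  -- a target value `±π` between `h c = 0` and `h x = 2πn`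
  set v : ℝ := if 0 < n then Real.pi else -Real.pi with hv
  have hvmem : v ∈ uIcc (h c) (h x) := by
    rw [h0, hn, mem_uIcc]
    by_cases hpos : 0 < n
    · have : (1 : ℝ) ≤ n := by exact_mod_cast hpos
      left; simp only [hv, hpos, ↓reduceIte]
      constructor
      · positivity
      · nlinarith [Real.pi_pos]
    · have hneg : n < 0 := lt_of_le_of_ne (not_lt.1 hpos) hn0
      have : (n : ℝ) ≤ -1 := by exact_mod_cast Int.le_sub_one_of_lt hneg
      right; simp only [hv, hpos, ↓reduceIte]
      constructor
      · nlinarith [Real.pi_pos]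
      · linarith [Real.pi_pos]
  obtain ⟨y, hy, hyv⟩ := intermediate_value_uIcc hcont hvmem
  obtain ⟨m, hm⟩ := hval y (hsub hy)
  rw [hm] at hyv
  -- `2πm = ±π` is impossible for an integer `m`
  by_cases hpos : 0 < n
  · simp only [hv, hpos, ↓reduceIte] at hyv
    have : (2 * m : ℝ) = 1 := by
      have := hyv; field_simp at this; linarith
    have h2 : (2 * m : ℤ) = 1 := by exact_mod_cast this
    omega
  · simp only [hv, hpos, ↓reduceIte] at hyv
    have : (2 * m : ℝ) = -1 := by
      have := hyv; field_simp at this; linarith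
    have h2 : (2 * m : ℤ) = -1 := by exact_mod_cast this
    omega

/-- **Normalised logarithms under an exponential growth bound.** Let `F` be holomorphic and
zero-free on the disc `B(c, R)` about a real centre `c`, real and positive on the real diameter, with
`e^{-KV} ≤ |F(c)|` and `|F| ≤ e^{KV}` on the disc (`V ≥ 1` a volume, `K ≥ 0`). Then
`F = exp(V·G)` for a holomorphic `G` on `B(c, R)` which is REAL on the diameter, equal there to
`V⁻¹ log |F|`, and bounded by `5K + 2` on `B(c, R/2)` — uniformly in `V` (holomorphic logarithm on
a disc + Borel–Carathéodory). [folklore] -/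
theorem exists_normalisedLog {F : ℂ → ℂ} {c R K V : ℝ} (hR : 0 < R) (hV : 1 ≤ V) (hK : 0 ≤ K)
    (hF : DifferentiableOn ℂ F (ball (c : ℂ) R)) (hF0 : ∀ z ∈ ball (c : ℂ) R, F z ≠ 0)
    (hub : ∀ z ∈ ball (c : ℂ) R, ‖F z‖ ≤ Real.exp (K * V))
    (hlb : Real.exp (-(K * V)) ≤ ‖F c‖)
    (hreal : ∀ x : ℝ, (x : ℂ) ∈ ball (c : ℂ) R → ∃ y : ℝ, 0 < y ∧ F x = y) :
    ∃ G : ℂ → ℂ, DifferentiableOn ℂ G (ball (c : ℂ) R) ∧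
      (∀ z ∈ ball (c : ℂ) R, F z = exp (V * G z)) ∧
      (∀ x : ℝ, (x : ℂ) ∈ ball (c : ℂ) R → G x = ((Real.log ‖F x‖ / V : ℝ) : ℂ)) ∧
      ∀ z ∈ ball (c : ℂ) (R / 2), ‖G z‖ ≤ 5 * K + 2 := by
  have hV0 : 0 < V := lt_of_lt_of_le one_pos hV
  obtain ⟨φ, hφd, hφc, -, hφexp⟩ := exists_log_on_ball hF hF0
  obtain ⟨yc, hyc, hFc⟩ := hreal c (mem_ball_self hR)
  have hFc' : ‖F c‖ = yc := by rw [hFc, Complex.norm_real, Real.norm_eq_abs, abs_of_pos hyc]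
  -- the real part of `φ` is bounded by `2KV`
  have hre : ∀ z ∈ ball (c : ℂ) R, (φ z).re ≤ 2 * (K * V) := by
    intro z hz
    have h1 : ‖F z‖ = yc * Real.exp (φ z).re := by
      rw [hφexp z hz, norm_mul, hFc', Complex.norm_exp]
    have h2 : yc * Real.exp (φ z).re ≤ Real.exp (K * V) := h1 ▸ hub z hz
    have h3 : Real.exp (-(K * V)) * Real.exp (φ z).re ≤ Real.exp (K * V) :=
      le_trans (mul_le_mul_of_nonneg_right (hFc' ▸ hlb) (Real.exp_pos _).le) h2
    rw [← Real.exp_add] at h3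
    have := Real.exp_le_exp.1 h3
    linarith
  -- Borel–Carathéodory on the translated disc
  set M : ℝ := 2 * (K * V) + 1 with hM
  have hM0 : 0 < M := by
    have : 0 ≤ K * V := by positivity
    linarith
  have hφbound : ∀ z ∈ ball (c : ℂ) (R / 2), ‖φ z‖ ≤ 2 * M := by
    intro z hz
    set ψ : ℂ → ℂ := fun w => φ (c + w) with hψ
    have hmaps : ∀ w ∈ ball (0 : ℂ) R, (c : ℂ) + w ∈ ball (c : ℂ) R := fun w hw => by
      simpa [mem_ball, dist_eq_norm] using hw
    have hψd : DifferentiableOn ℂ ψ (ball 0 R) :=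
      hφd.comp ((differentiable_id.const_add _).differentiableOn) fun w hw => hmaps w hw
    have hψre : MapsTo ψ (ball 0 R) {z | z.re ≤ M} := fun w hw => by
      have := hre _ (hmaps w hw); simp only [mem_setOf_eq, hψ]; linarith
    have hψ0 : ψ 0 = 0 := by simp [hψ, hφc]
    have hw : z - c ∈ ball (0 : ℂ) R := by
      have : dist z c < R := lt_trans (mem_ball.1 hz) (by linarith)
      simpa [mem_ball, dist_eq_norm] using this
    have key := Complex.borelCaratheodory_zero hM0 hψd hψre hR hw hψ0
    have hzc : ‖z - (c : ℂ)‖ < R / 2 := by simpa [mem_ball, dist_eq_norm] using hz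
    have hψz : ψ (z - c) = φ z := by simp [hψ]
    rw [hψz] at key
    refine key.trans ?_
    rw [div_le_iff₀ (by linarith)]
    nlinarith [norm_nonneg (z - (c : ℂ))]
  -- the logarithm of `F c`
  have hlogc : |Real.log yc| ≤ K * V := by
    rw [abs_le]
    constructor
    · have := Real.log_le_log (Real.exp_pos _) (hFc' ▸ hlb)
      rwa [Real.log_exp] at this
    · have := Real.log_le_log hyc (hFc' ▸ hub c (mem_ball_self hR))
      rwa [Real.log_exp] at this
  -- `φ` is real on the diameter
  have hφim : ∀ x : ℝ, (x : ℂ) ∈ ball (c : ℂ) R → (φ x).im = 0 := by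
    intro x hx
    have hIoo : ∀ y : ℝ, (y : ℂ) ∈ ball (c : ℂ) R ↔ y ∈ Ioo (c - R) (c + R) := fun y => by
      rw [ofReal_mem_ball_iff, abs_lt, mem_Ioo]; constructor <;> intro h <;> constructor <;> linarith
    refine eq_zero_of_continuousOn_of_two_pi_int (h := fun y : ℝ => (φ y).im) (c := c) (R := R)
      ?_ (by simp [hφc]) ?_ ((hIoo x).1 hx)
    · have hcont : ContinuousOn φ (ball (c : ℂ) R) := hφd.continuousOn
      refine (Complex.continuous_im.comp_continuousOn (hcont.comp Complex.continuous_ofReal.continuousOn ?_))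
      exact fun y hy => (hIoo y).2 hy
    · intro y hy
      obtain ⟨yy, hyy, hFy⟩ := hreal y ((hIoo y).2 hy)
      have h1 : exp (φ y) = ((yy / yc : ℝ) : ℂ) := by
        have h2 := hφexp y ((hIoo y).2 hy)
        rw [hFy, hFc] at h2
        have hyc0 : (yc : ℂ) ≠ 0 := Complex.ofReal_ne_zero.2 hyc.ne'
        field_simp
        rw [Complex.ofReal_div]
        field_simp
        rw [mul_comm]; exact h2.symm
      have h3 : exp (φ y) = exp ((Real.log (yy / yc) : ℝ) : ℂ) := by
        rw [h1, ← Complex.ofReal_exp, Real.exp_log (div_pos hyy hyc)]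
      obtain ⟨n, hn⟩ := Complex.exp_eq_exp_iff_exists_int.1 h3
      refine ⟨n, ?_⟩
      have := congrArg Complex.im hn
      simp only [Complex.add_im, Complex.ofReal_im, Complex.mul_im, Complex.intCast_re,
        Complex.intCast_im, Complex.mul_re, Complex.re_ofNat, Complex.ofReal_re, Complex.im_ofNat,
        Complex.ofReal_im, Complex.I_re, Complex.I_im, zero_add, mul_zero, sub_zero, zero_mul,
        mul_one, add_zero] at this
      rw [this]; ring
  -- the normalised logarithm
  refine ⟨fun z => ((Real.log yc : ℝ) : ℂ) / V + φ z / V, ?_, ?_, ?_, ?_⟩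
  · exact (differentiableOn_const _).add (hφd.div_const _)
  · intro z hz
    have hV' : (V : ℂ) ≠ 0 := Complex.ofReal_ne_zero.2 hV0.ne'
    have : (V : ℂ) * (((Real.log yc : ℝ) : ℂ) / V + φ z / V) = ((Real.log yc : ℝ) : ℂ) + φ z := by
      field_simp
    rw [this, Complex.exp_add, ← Complex.ofReal_exp, Real.exp_log hyc, ← hFc]
    exact hφexp z hz
  · intro x hx
    have hre' : (φ x).re = Real.log ‖F x‖ - Real.log yc := by
      have h1 : ‖F x‖ = yc * Real.exp (φ x).re := by
        rw [hφexp x hx, norm_mul, hFc', Complex.norm_exp]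
      rw [h1, Real.log_mul hyc.ne' (Real.exp_pos _).ne', Real.log_exp]; ring
    apply Complex.ext
    · simp only [Complex.add_re, Complex.div_ofReal_re, Complex.ofReal_re, hre']
      field_simp; ring
    · simp only [Complex.add_im, Complex.div_ofReal_im, Complex.ofReal_im, hφim x hx, zero_div,
        add_zero]
  · intro z hz
    have h1 : ‖((Real.log yc : ℝ) : ℂ) / V + φ z / V‖ ≤ (K * V) / V + (2 * M) / V := by
      refine (norm_add_le _ _).trans (add_le_add ?_ ?_)
      · rw [norm_div, Complex.norm_real, Complex.norm_real, Real.norm_eq_abs, Real.norm_eq_abs,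
          abs_of_pos hV0]
        exact div_le_div_of_nonneg_right hlogc hV0.le
      · rw [norm_div, Complex.norm_real, Real.norm_eq_abs, abs_of_pos hV0]
        exact div_le_div_of_nonneg_right (hφbound z hz) hV0.le
    refine h1.trans ?_
    rw [hM, ← add_div, div_le_iff₀ hV0]
    nlinarith

/-- **Vitali on a disc with real limits.** Holomorphic functions on `B(c, r)` (`c` real) bounded
by one constant `B` and converging at every real point of the diameter to real values `g(x)`
converge locally uniformly to a holomorphic `G` with `G = g` on the diameter and `|G| ≤ B`
(Montel + identity theorem: the real diameter accumulates at `c`). [folklore] -/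
theorem exists_limit_of_real_limits {Gs : ℕ → ℂ → ℂ} {c r B : ℝ} (hr : 0 < r)
    (hG : ∀ n, DifferentiableOn ℂ (Gs n) (ball (c : ℂ) r))
    (hB : ∀ n, ∀ z ∈ ball (c : ℂ) r, ‖Gs n z‖ ≤ B) {g : ℝ → ℝ}
    (hlim : ∀ x : ℝ, (x : ℂ) ∈ ball (c : ℂ) r →
      Tendsto (fun n => Gs n x) atTop (𝓝 ((g x : ℝ) : ℂ))) :
    ∃ Gl : ℂ → ℂ, DifferentiableOn ℂ Gl (ball (c : ℂ) r) ∧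
      TendstoLocallyUniformlyOn Gs Gl atTop (ball (c : ℂ) r) ∧
      (∀ x : ℝ, (x : ℂ) ∈ ball (c : ℂ) r → Gl x = g x) ∧ ∀ z ∈ ball (c : ℂ) r, ‖Gl z‖ ≤ B := by
  have hb : ∀ a ∈ ball (c : ℂ) r, ∃ M : ℝ, ∃ r' > 0, ∀ n, ∀ z ∈ ball a r' ∩ ball (c : ℂ) r,
      ‖Gs n z‖ ≤ M := fun a _ => ⟨B, 1, one_pos, fun n z hz => hB n z hz.2⟩
  -- the real points `c + r/(k+2)` accumulate at `c` and carry limits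
  have hS : ∃ᶠ z in 𝓝[≠] (c : ℂ), ∃ l : ℂ, Tendsto (fun n => Gs n z) atTop (𝓝 l) := by
    set u : ℕ → ℂ := fun k => ((c + r / ((k : ℝ) + 2) : ℝ) : ℂ) with hu
    have hu_tend : Tendsto u atTop (𝓝[≠] (c : ℂ)) := by
      refine tendsto_nhdsWithin_iff.2 ⟨?_, Eventually.of_forall fun k => ?_⟩
      · have h1 : Tendsto (fun k : ℕ => c + r / ((k : ℝ) + 2)) atTop (𝓝 (c + 0)) := by
          refine tendsto_const_nhds.add ?_
          refine Tendsto.div_atTop tendsto_const_nhds ?_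
          exact tendsto_natCast_atTop_atTop.atTop_add tendsto_const_nhds
        rw [add_zero] at h1
        exact (Complex.continuous_ofReal.tendsto c).comp h1
      · have hk : (0 : ℝ) < r / ((k : ℝ) + 2) := by positivity
        simp only [hu, mem_compl_iff, mem_singleton_iff, Complex.ofReal_inj]
        linarith
    refine hu_tend.frequently (Eventually.of_forall fun k => ?_).frequently
    have hmem : u k ∈ ball (c : ℂ) r := by
      simp only [hu]
      rw [ofReal_mem_ball_iff, add_sub_cancel_left, abs_of_pos (by positivity)]
      rw [div_lt_iff₀ (by positivity)]
      have : (0 : ℝ) ≤ k := Nat.cast_nonneg k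
      nlinarith
    exact ⟨_, hlim _ hmem⟩
  obtain ⟨Gl, hGld, hGl⟩ := exists_tendstoLocallyUniformlyOn_of_frequently_tendsto isOpen_ball
    (convex_ball _ _).isPreconnected hG hb (mem_ball_self hr) hS
  refine ⟨Gl, hGld, hGl, fun x hx => ?_, fun z hz => ?_⟩
  · exact tendsto_nhds_unique (hGl.tendsto_at hx) (hlim x hx)
  · exact le_of_tendsto' ((hGl.tendsto_at hz).norm) fun n => hB n z hz

/-- A real function that agrees on the real diameter of a disc with a holomorphic function is real
analytic at the centre. [folklore] -/
theorem analyticAt_of_eq_on_diameter {Gl : ℂ → ℂ} {c r : ℝ} (hr : 0 < r)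
    (hGl : DifferentiableOn ℂ Gl (ball (c : ℂ) r)) {g : ℝ → ℝ}
    (hg : ∀ x : ℝ, (x : ℂ) ∈ ball (c : ℂ) r → Gl x = g x) : AnalyticAt ℝ g c := by
  have hA : AnalyticAt ℂ Gl (c : ℂ) := hGl.analyticAt (isOpen_ball.mem_nhds (mem_ball_self hr))
  have hH : AnalyticAt ℝ (fun x : ℝ => (Gl (x : ℂ)).re) c := by
    refine (Complex.reCLM.analyticAt _).comp ?_
    exact (hA.restrictScalars (𝕜 := ℝ)).comp (Complex.ofRealCLM.analyticAt c)
  refine hH.congr ?_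
  have hev : ∀ᶠ x : ℝ in 𝓝 c, ((x : ℝ) : ℂ) ∈ ball (c : ℂ) r := by
    have : Ioo (c - r) (c + r) ∈ 𝓝 c := Ioo_mem_nhds (by linarith) (by linarith)
    filter_upwards [this] with x hx
    rw [ofReal_mem_ball_iff, abs_lt]; constructor <;> linarith [hx.1, hx.2]
  filter_upwards [hev] with x hx
  simp [hg x hx]

/-- **Uniform zero-freeness about a real point makes the limiting free energy analytic there**
(iterated-limit form matching the crux's `∃ L₀ ∀ L ≥ L₀ ∃ t₀ ∀ t ≥ t₀`). Let `Z L t` be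
holomorphic on `B(c, R)`, real and positive on the diameter, with the volume bounds
`e^{-K V} ≤ |Z(c)|`, `|Z| ≤ e^{K V}` (`V = V L t ≥ 1`), and suppose the tube rates
`e L x = lim_t V⁻¹ log |Z L t x|` and the free energy `f x = lim_L e L x` exist on the real
diameter. If the `Z L t` are zero-free on `B(c, R)` for `L ≥ L₀`, `t ≥ t₀(L)`, then `f` is real
analytic at `c`. (Holomorphic `V⁻¹ log Z`, Borel–Carathéodory, Vitali twice.) [folklore] -/
theorem analyticAt_of_uniformly_zeroFree {Z : ℕ → ℕ → ℂ → ℂ} {V : ℕ → ℕ → ℝ} {c R K : ℝ}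
    (hR : 0 < R) (hK : 0 ≤ K)
    (hV : ∀ L t, 1 ≤ L → 1 ≤ t → 1 ≤ V L t)
    (hZd : ∀ L t, 1 ≤ L → 1 ≤ t → DifferentiableOn ℂ (Z L t) (ball (c : ℂ) R))
    (hub : ∀ L t, 1 ≤ L → 1 ≤ t → ∀ z ∈ ball (c : ℂ) R, ‖Z L t z‖ ≤ Real.exp (K * V L t))
    (hlb : ∀ L t, 1 ≤ L → 1 ≤ t → Real.exp (-(K * V L t)) ≤ ‖Z L t c‖)
    (hreal : ∀ L t, 1 ≤ L → 1 ≤ t → ∀ x : ℝ, (x : ℂ) ∈ ball (c : ℂ) R → ∃ y : ℝ, 0 < y ∧ Z L t x = y)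
    (hzf : ∃ L₀ : ℕ, ∀ L, L₀ ≤ L → ∃ t₀ : ℕ, ∀ t, t₀ ≤ t → ∀ z ∈ ball (c : ℂ) R, Z L t z ≠ 0)
    {e : ℕ → ℝ → ℝ} {f : ℝ → ℝ}
    (he : ∃ L₁ : ℕ, ∀ L, L₁ ≤ L → ∀ x : ℝ, (x : ℂ) ∈ ball (c : ℂ) R →
      Tendsto (fun t => Real.log ‖Z L t x‖ / V L t) atTop (𝓝 (e L x)))
    (hf : ∀ x : ℝ, (x : ℂ) ∈ ball (c : ℂ) R → Tendsto (fun L => e L x) atTop (𝓝 (f x))) :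
    AnalyticAt ℝ f c := by
  obtain ⟨L₀, hL₀⟩ := hzf
  obtain ⟨L₁, hL₁⟩ := he
  have hR2 : 0 < R / 2 := half_pos hR
  have hsub : ball (c : ℂ) (R / 2) ⊆ ball (c : ℂ) R := ball_subset_ball (by linarith)
  set L' : ℕ := max (max L₀ L₁) 1 with hL'
  -- INNER STEP: for every `L ≥ L'` a holomorphic `Hh` on `B(c, R/2)`, `|Hh| ≤ 5K+2`, `Hh = e L` on the diameter
  have inner : ∀ L, L' ≤ L → ∃ Hh : ℂ → ℂ, DifferentiableOn ℂ Hh (ball (c : ℂ) (R / 2)) ∧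
      (∀ x : ℝ, (x : ℂ) ∈ ball (c : ℂ) (R / 2) → Hh x = e L x) ∧
      ∀ z ∈ ball (c : ℂ) (R / 2), ‖Hh z‖ ≤ 5 * K + 2 := by
    intro L hL
    have hLL₀ : L₀ ≤ L := le_trans (le_trans (le_max_left _ _) (le_max_left _ _)) hL
    have hLL₁ : L₁ ≤ L := le_trans (le_trans (le_max_right _ _) (le_max_left _ _)) hL
    have hL1 : 1 ≤ L := le_trans (le_max_right _ _) hL
    obtain ⟨t₀, ht₀⟩ := hL₀ L hLL₀
    set t' : ℕ := max t₀ 1 with ht'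
    have hlog : ∀ n : ℕ, ∃ G : ℂ → ℂ, DifferentiableOn ℂ G (ball (c : ℂ) R) ∧
        (∀ x : ℝ, (x : ℂ) ∈ ball (c : ℂ) R →
          G x = ((Real.log ‖Z L (t' + n) x‖ / V L (t' + n) : ℝ) : ℂ)) ∧
        ∀ z ∈ ball (c : ℂ) (R / 2), ‖G z‖ ≤ 5 * K + 2 := by
      intro n
      have ht1 : 1 ≤ t' + n := le_trans (le_max_right _ _) (Nat.le_add_right _ _)
      have ht0 : t₀ ≤ t' + n := le_trans (le_max_left _ _) (Nat.le_add_right _ _)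
      obtain ⟨G, hGd, -, hGx, hGb⟩ := exists_normalisedLog hR (hV L _ hL1 ht1) hK (hZd L _ hL1 ht1)
        (ht₀ _ ht0) (hub L _ hL1 ht1) (hlb L _ hL1 ht1) (hreal L _ hL1 ht1)
      exact ⟨G, hGd, hGx, hGb⟩
    choose Gs hGsd hGsx hGsb using hlog
    have hlim : ∀ x : ℝ, (x : ℂ) ∈ ball (c : ℂ) (R / 2) →
        Tendsto (fun n => Gs n x) atTop (𝓝 ((e L x : ℝ) : ℂ)) := by
      intro x hx
      have hxR : (x : ℂ) ∈ ball (c : ℂ) R := hsub hx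
      have h1 : Tendsto (fun t => Real.log ‖Z L t x‖ / V L t) atTop (𝓝 (e L x)) := hL₁ L hLL₁ x hxR
      have h2 : Tendsto (fun n => Real.log ‖Z L (t' + n) x‖ / V L (t' + n)) atTop (𝓝 (e L x)) := by
        have := (tendsto_add_atTop_iff_nat t').2 h1
        simpa only [add_comm] using this
      have h3 := ((Complex.continuous_ofReal.tendsto _).comp h2)
      refine h3.congr fun n => ?_
      simp only [Function.comp_apply, hGsx n x hxR]
    obtain ⟨Hh, hHd, -, hHx, hHb⟩ := exists_limit_of_real_limits hR2
      (fun n => (hGsd n).mono hsub) (fun n z hz => hGsb n z hz) hlim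
    exact ⟨Hh, hHd, hHx, hHb⟩
  -- choose the inner limits (junk below `L'`)
  have inner' : ∀ L, ∃ Hh : ℂ → ℂ, L' ≤ L → (DifferentiableOn ℂ Hh (ball (c : ℂ) (R / 2)) ∧
      (∀ x : ℝ, (x : ℂ) ∈ ball (c : ℂ) (R / 2) → Hh x = e L x) ∧
      ∀ z ∈ ball (c : ℂ) (R / 2), ‖Hh z‖ ≤ 5 * K + 2) := by
    intro L
    by_cases h : L' ≤ L
    · obtain ⟨Hh, hH⟩ := inner L h
      exact ⟨Hh, fun _ => hH⟩
    · exact ⟨0, fun h' => absurd h' h⟩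
  choose Hs hHs using inner'
  -- OUTER STEP: Vitali for `n ↦ Hs (L' + n)` on `B(c, R/2)` with the real limits `f`
  have hlim' : ∀ x : ℝ, (x : ℂ) ∈ ball (c : ℂ) (R / 2) →
      Tendsto (fun n => Hs (L' + n) x) atTop (𝓝 ((f x : ℝ) : ℂ)) := by
    intro x hx
    have h1 : Tendsto (fun L => e L x) atTop (𝓝 (f x)) := hf x (hsub hx)
    have h2 : Tendsto (fun n => e (L' + n) x) atTop (𝓝 (f x)) := by
      have := (tendsto_add_atTop_iff_nat L').2 h1
      simpa only [add_comm] using this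
    have h3 := ((Complex.continuous_ofReal.tendsto _).comp h2)
    refine h3.congr fun n => ?_
    simp only [Function.comp_apply, (hHs (L' + n) (Nat.le_add_right _ _)).2.1 x hx]
  obtain ⟨Gtop, hGtopd, -, hGtopx, -⟩ := exists_limit_of_real_limits hR2
    (fun n => (hHs (L' + n) (Nat.le_add_right _ _)).1)
    (fun n z hz => (hHs (L' + n) (Nat.le_add_right _ _)).2.2 z hz) hlim'
  exact analyticAt_of_eq_on_diameter hR2 hGtopd hGtopx

end Analysis

end Summit.QuantumFields.YangMills.Theorems.TubeZeroFreeChannel.Negative
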